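import Summits.QuantumFields.YangMills.Theorems.BalabanUVNodesN22EdgeAtW1AdmReadingOfRecord12
import Literature.MathematicalPhysics.QuantumFieldTheory.Balaban1983to89.Node00.HistoryRecursionOfRecord

/-!
# N22 AT THE ADMISSIBLE READING OF RECORD ON W1's GENERATED RUN TOWERS `runTowers (fun k ↦ toClusterTower (G k))` — «`FadingMemory` BY NAME FROM A MODULUS»
# READ ON THE OBJECT: the junk-freeness pin (J) is node00-def-W1 g4's THEOREM, the pairing coherence and the readings clause are the slot's TYPE, and the
# analytic letter (A)'s extension ∕ holomorphy ∕ agreement clauses are W1's RECURSION (`analyticInEach_recTerm`) — so that N22's own displayed residual at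
# this reading is ONE INEQUALITY SCHEMA on the generated terms (a complex sup letter) next to the per-step analyticity schemas, node N18 and the numerals

Track A of `YM-PLAN.md` (cell `pub-ymgap`, HUMAN RULING D-0062), R134 seat `pub-ymgap-dag-n22-e` ((T-RATE) pen ∕ N22 NE9 s2 «`FadingMemory` by name from a modulus + knit at
the ₁₂ record»), gen 4, module 8b.  THEOREMS ONLY (no `def`, no `sorry`); `--supports` K3″ `SpineGivenEndpointR12` (stmt-QuantumFields-19908) as a helper; restate-immune
(no Theses import).  Imports module 8a (`…N22EdgeAtW1AdmReadingOfRecord12`: module 7's θ-form ∕ module 7b's edges at `ReadingData.ofRecordAdm`) and node00-def-W1 g4's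
`Node00.HistoryRecursionOfRecord` (run lengths `truncRun` ∕ `runTowers` ∕ `TermlessBeyond`; the recursion `StepGen` ∕ `recTerm` ∕ `toClusterTower`; the per-step schemas
`StepGen.AnalyticInLast`, `StepGen.PropagatesAnalyticity`, `RecAdmissible`; `analyticInEach_recTerm`).

WHY.  NODE-TABLE row N22: «wall = the one-step RG model W1 = [II] §2 (2.13)–(2.14) as a Lean OBJECT».  At the W1 reading the by-name state after dag-n22-c g3 ∕ my g3 is
`S_N22 (RRec₁₂ 𝔯_W1)` ⇐ `S_N18` + a regularity letter for the terms in the young couplings (STRIP ∕ (A)) + the pairing coherence + the readings clause + the junk pin (J) +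
numerals.  With W1 g4's object the last three are THEOREMS ∕ TYPES, and the analytic letter (A) (module 4's ROAD-3 `hA`: «per young coupling `i < j` a complex-differentiable
EXTENSION of `t ↦ Re E^{(j)}(X; g[i ↦ t]; (ιU, 0))` on a set containing the closed `li.r`-discs about `]0, θ.γ]`, with sup letter `li.A·li.μ^{j−1−i}·e^{−li.κ d_j(X)}`»)
SPLITS on the generated tower: the EXTENSION is the generated term itself at the complexified coupling, `z ↦ recTerm (G k) (↑g[i ↦ z]) j X (ιU, 0)`, HOLOMORPHIC on the
schemas' domain `Dk` by W1's induction on the recursion (`analyticInEach_recTerm`: levels `≤ i` do not read `g_i`, level `i + 1` reads it as last coupling — schema (A-last) —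
the higher levels through the older terms — schema (A-prop)), its REAL PART on the real couplings is carried by the Schwarz symmetrisation `z ↦ (f z + conj (f (conj z)))∕2`
(holomorphic on a conjugation-symmetric `Dk`, Mathlib `DifferentiableAt.conj_conj`), and AGREEMENT on `]0, θ.γ]` is `termC_toClusterTower` + the run-length faces.  What is
NOT structural is the BOUND: the complex sup letter `‖recTerm (G k) (↑g[i ↦ z]) j X φ‖ ≤ li.A·li.μ^{j−1−i}·e^{−li.κ d_j(X)}` for `z ∈ Dk`, `φ` in the term's space — (1.18) of
[Balaban1987RG1] p. 263 READ AT COMPLEX VALUES OF ONE YOUNG COUPLING with the ROAD-3 fading allowance `μ^{j−1−i}` (NOT PRINTED: p. 263 gives «C^∞ (or analytic)» in the last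
coupling on `[0, γ]`, p. 266 «analytic functions of the effective coupling constants», with no uniform complex neighbourhood or bound).  That inequality is displayed, as
ONE schema on the object, and is N22's own residual at this reading (beside node N18, the two qualitative per-step schemas with their admissibility bookkeeping, and the
numerals).  This is the s2 row «`FadingMemory` by name from a modulus» with the modulus = (disc radius `li.r`, sup letter `li.A`, allowance `li.μ`) of the generated terms.

WHAT THIS MODULE PROVES ([folklore] bookkeeping + ≈ 40 lines of Mathlib complex calculus; every estimate stays a displayed hypothesis).
* §1 **`supLetterA_truncRun_toClusterTower_of_schemas`** (one torus `P`, generic coefficients `𝔸`): for a generator `G`, a run length `K`, a space table `sp`, an OPEN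
  CONJUGATION-SYMMETRIC `Dk ⊇` the closed `r`-discs about `]0, γ]` (`0 ≤ r`), admissible classes with `RecAdmissible G Dk Adm`, the schemas (A-last)ₘ, (A-prop)ₘ at every
  step on `Dk`, letters `A, μ ≥ 0`, and the complex sup-letter inequality for the levels `j ≤ K` ⟹ module 4's `hA` literal for the functional of the RUN TOWER
  `truncRun K (toClusterTower G)` at every configuration `φ` lying in all spaces (witness `Fz := (f + conj ∘ f ∘ conj)∕2`, `Dset := Dk`; beyond the run `Fz := 0`).
* §2 θ-form **`n22At_u3OfRecord₁₂_ofRecordAdm_gen_of_n18Below_schemas`**: at ONE Stage-12 tuple, for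
  `D := ReadingData.ofRecordAdm F θ.τ9.M N (runTowers fun k ↦ toClusterTower (G k)) sp gauge hg T₀ hT₀ li`: `N18At` below `k` + the schema PACKAGE at the `k`-th torus
  (`∃ Dk Adm, IsOpen Dk ∧ conj-symmetric ∧ ⊇ closed li.r-discs ∧ RecAdmissible ∧ (A-last) ∧ (A-prop) ∧ complex sup letter`) + the eleven numerals + `0 < θ.γ` ⟹
  `N22At (u3OfRecord₁₂ θ (D.u3Objects θ.γ) k)` — module 8a §1 with (J) := `termlessBeyond_runTowers` and (A) := §1.  NO junk pin, NO coherence, NO readings clause.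
* §3 stub level: **`s_N22_rRec₁₂_w1_gen_of_s_N18_schemas`** (canonical home `RRec₁₂ 𝔯_W1`, ANY residual inputs `𝔇` whose W1 component IS that reading — hypothesis `h𝔇`),
  **`s_N22_rRec₁₂On_w1_gen_of_s_N18_schemas`** (regime ∕ tuple home `RRec₁₂On 𝔯_W1 Rg`, any `Rg`), **`s_N22_readingOfRecord₁₂_gen_of_s_N18_schemas`** ∕
  **`s_N22_readingOfRecord₁₂On_gen_of_s_N18_schemas`** (reading of record, edition 1, canonical ∕ regime home, `h𝔇 := rfl` — the two forms dag-n27-c's Stage-12 composers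
  read): `S_N18` at the same reading + the schema package per admissible tuple with provisos (in the regime) and run length + numerals ⟹ `S_N22`.
* §4 **`genSchemas_nonvacuous`** (referee standard A5): the schema package of §2 is SATISFIABLE — the TERMLESS generator (no indices: every (2.11) sum empty, every generated
  term `0`) with `Dk := univ`, `Adm := univ` carries it for any letters `A, μ ≥ 0`; so §2–§3 are not vacuous implications, and — honestly — INHABITATION IS NOT CONTENT: a
  discharge keyed to this reading NAMES its generator.

HONEST FRAMING.  COUNT-NEUTRAL kernel bookkeeping BY NAME; NE5 ∕ NE9 NOT PRINTED for d = 4 and NOT PROVED; the generators `G`, the table family `sp`, the gauge, `T₀` and its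
admissibility-preservation clause are PARAMETERS; node N18's stub, the per-step schemas (asserted nowhere — [Balaban1987RG1] p. 263 «(or analytic)» ∕ the (1.41)∘(2.14)
mechanism of [Balaban1988RG2Cluster], typed by node00-def-W1 g4 as hypotheses), the complex sup letter and the numerals are DISPLAYED hypotheses; the factorization of the
generic term through the potentials `V_k(Y, U_{k+1}, B)` is NOT typed (N10 ∕ NODE A own the integrand); nothing of Bałaban's is asserted; no inhabitant of any Stage-12 key
claimed (K0″ open); N22 NOT discharged; counts UNMOVED (typed 28∕28 · discharged 5∕27, A 5∕28); one finite four-torus programme at fixed `ε` — NOT ℝ⁴, NOT infinite volume,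
NOT OS, NOT a mass gap, NOT Clay.  No decl carries a cite tag.
-/

noncomputable section

namespace YMDAG.N22

open Set Metric ComplexConjugate
open scoped BigOperators
open Literature.MathematicalPhysics.QuantumFieldTheory.Balaban1983to89
open Literature.MathematicalPhysics.QuantumFieldTheory.Balaban1983to89.T4Continuum
open Literature.MathematicalPhysics.QuantumFieldTheory.Balaban1983to89.T4OutputRate
open Literature.MathematicalPhysics.QuantumFieldTheory.Balaban1983to89.Node00
  (Stage12Params NE2Objects₁₁ NE3Letters₁₁ MatA ιSU)
open Literature.MathematicalPhysics.QuantumFieldTheory.Balaban1983to89.Node00.Sect2 (domSys CPair ofBackgroundC)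
open Literature.MathematicalPhysics.QuantumFieldTheory.Balaban1983to89.Node00.W1
open YMDAG.UVSplit

variable {N : ℕ} [NeZero N]

/-! ## §1 The analytic letter (A) for the run tower of a generator, from the per-step schemas and a complex sup letter -/

section SupLetter

variable {P : Params} {𝔸 : Type*} {M : ℕ}

omit [NeZero N] in
/-- **THE ANALYTIC LETTER (A) ON A GENERATED RUN TOWER, FROM THE SCHEMAS.**  For a generator `G` on the torus `P`, a run length `K`, a space table `sp`, a window
radius `γ`, an OPEN CONJUGATION-SYMMETRIC set `Dk ⊆ ℂ` containing the closed `r`-discs about `]0, γ]` (`0 ≤ r`), admissible older-term classes with the bookkeeping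
`RecAdmissible G Dk Adm`, W1's schemas (A-last)ₘ and (A-prop)ₘ at every step on `Dk`, letters `A, μ ≥ 0`, and the COMPLEX SUP LETTER «for `g` in the window, `i < j ≤ K`,
`X ∈ 𝐃_j`, `φ ∈ sp j X`, `z ∈ Dk`: `‖recTerm G (↑g[i ↦ z]) j X φ‖ ≤ A·μ^{j−1−i}·e^{−κ d_j(X)}`»: every configuration `φ` lying in all spaces carries module 4's `hA` literal
for the (2.13) functional of the RUN TOWER `truncRun K (toClusterTower G)` — per `g`, `(j, X)`, `i < j` a function `Fz` complex-differentiable on a set `Dset ⊇` the closed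
`r`-discs with `‖Fz‖ ≤ A·μ^{j−1−i}·e^{−κ d_j(X)}` there and `Fz t = Re E^{(j)}_{run tower}(X; g[i ↦ t]; φ)` on `]0, γ]`.  Witness: `Dset := Dk`; within the run
`Fz z := (f z + conj (f (conj z)))∕2` with `f z := recTerm G (↑g[i ↦ z]) j X φ` (holomorphic by `analyticInEach_recTerm`; the reflection by `DifferentiableAt.conj_conj`;
`f t + conj (f t) = 2 Re f t`; `termC_toClusterTower` and `functionalC_truncRun_of_le` for the agreement); beyond the run `Fz := 0` (`functionalC_truncRun_eq_zero`). [folklore] -/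
theorem supLetterA_truncRun_toClusterTower_of_schemas (G : GenTower P 𝔸 M) (K : ℕ)
    (sp : (j : ℕ) → (domSys P M j).Dom → Set (CPair P 𝔸)) {γ A μ κ r : ℝ} {Dk : Set ℂ}
    (hDo : IsOpen Dk) (hDc : ∀ z ∈ Dk, conj z ∈ Dk) (hDr : ∀ t ∈ Ioc (0 : ℝ) γ, closedBall (t : ℂ) r ⊆ Dk) (hr : 0 ≤ r)
    {Adm : (m : ℕ) → Set (OlderTerms P 𝔸 M m)} (hAdm : RecAdmissible G Dk Adm)
    (hlast : ∀ m : ℕ, (G m).AnalyticInLast Dk (Adm m) (sp (m + 1)))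
    (hprop : ∀ m : ℕ, (G m).PropagatesAnalyticity Dk (Adm m) (fun j : Fin (m + 1) => sp j) (sp (m + 1)))
    (hA0 : 0 ≤ A) (hμ : 0 ≤ μ)
    (hB : ∀ g ∈ Window γ, ∀ (i j : ℕ), i < j → j ≤ K → ∀ (X : (domSys P M j).Dom), ∀ φ ∈ sp j X, ∀ z ∈ Dk,
      ‖recTerm G (Function.update (fun n => ((g n : ℝ) : ℂ)) i z) j X φ‖ ≤ A * μ ^ (j - 1 - i) * Real.exp (-(κ * (domSys P M j).dj X)))
    (φ : CPair P 𝔸) (hφ : ∀ (j : ℕ) (Y : (domSys P M j).Dom), φ ∈ sp j Y) :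
    ∀ g ∈ Window γ, ∀ (X : Node00.W1.Dom P M) (i : ℕ), i < X.1 →
      ∃ (Fz : ℂ → ℂ) (Dset : Set ℂ), DifferentiableOn ℂ Fz Dset ∧
        (∀ z ∈ Dset, ‖Fz z‖ ≤ A * μ ^ (X.1 - 1 - i) * Real.exp (-(κ * (domSys P M X.1).dj X.2))) ∧
        (∀ t ∈ Ioc (0 : ℝ) γ, closedBall (t : ℂ) r ⊆ Dset) ∧
        (∀ t ∈ Ioc (0 : ℝ) γ, Fz t = ((functionalC (truncRun K (toClusterTower G)) (Function.update g i t) φ X).re : ℂ)) := by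
  intro g hg X i hi
  have hbd : 0 ≤ A * μ ^ (X.1 - 1 - i) * Real.exp (-(κ * (domSys P M X.1).dj X.2)) :=
    mul_nonneg (mul_nonneg hA0 (pow_nonneg hμ _)) (Real.exp_nonneg _)
  rcases Nat.lt_or_ge K X.1 with hXK | hXK
  · -- beyond the run length: the term, hence the functional, is zero
    refine ⟨fun _ => 0, Dk, differentiableOn_const _, fun z _ => ?_, hDr, fun t _ => ?_⟩
    · show ‖(0 : ℂ)‖ ≤ _
      rw [norm_zero]
      exact hbd
    · show (0 : ℂ) = _
      rw [functionalC_truncRun_eq_zero _ _ φ X hXK, Complex.zero_re, Complex.ofReal_zero]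
  · -- within the run: the generated term at the complexified coupling, Schwarz-symmetrised
    have hg' : ∀ n, 0 < g n ∧ g n ≤ γ := hg
    have hgc : ∀ n, (fun n => ((g n : ℝ) : ℂ)) n ∈ Dk := fun n =>
      hDr (g n) ⟨(hg' n).1, (hg' n).2⟩ (mem_closedBall_self hr)
    have hf : DifferentiableOn ℂ (fun z => recTerm G (Function.update (fun n => ((g n : ℝ) : ℂ)) i z) X.1 X.2 φ) Dk :=
      (analyticInEach_recTerm G (sp := sp) hAdm hlast hprop X.1 _ hgc i hi X.2 φ (hφ X.1 X.2)).differentiableOn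
    have hfc : DifferentiableOn ℂ (fun z => conj (recTerm G (Function.update (fun n => ((g n : ℝ) : ℂ)) i (conj z)) X.1 X.2 φ)) Dk := by
      intro z hz
      have hd : DifferentiableAt ℂ (fun z => recTerm G (Function.update (fun n => ((g n : ℝ) : ℂ)) i z) X.1 X.2 φ) (conj z) :=
        hf.differentiableAt (hDo.mem_nhds (hDc z hz))
      have := hd.conj_conj
      rw [Complex.conj_conj] at this
      exact this.differentiableWithinAt
    refine ⟨fun z => (recTerm G (Function.update (fun n => ((g n : ℝ) : ℂ)) i z) X.1 X.2 φ +
        conj (recTerm G (Function.update (fun n => ((g n : ℝ) : ℂ)) i (conj z)) X.1 X.2 φ)) / 2,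
      Dk, (hf.add hfc).div_const 2, fun z hz => ?_, hDr, fun t ht => ?_⟩
    · have h1 := hB g hg i X.1 hi hXK X.2 φ (hφ X.1 X.2) z hz
      have h2 := hB g hg i X.1 hi hXK X.2 φ (hφ X.1 X.2) (conj z) (hDc z hz)
      have h3 : ‖(recTerm G (Function.update (fun n => ((g n : ℝ) : ℂ)) i z) X.1 X.2 φ +
          conj (recTerm G (Function.update (fun n => ((g n : ℝ) : ℂ)) i (conj z)) X.1 X.2 φ)) / 2‖ ≤
          (‖recTerm G (Function.update (fun n => ((g n : ℝ) : ℂ)) i z) X.1 X.2 φ‖ +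
            ‖recTerm G (Function.update (fun n => ((g n : ℝ) : ℂ)) i (conj z)) X.1 X.2 φ‖) / 2 := by
        rw [norm_div, Complex.norm_two]
        gcongr
        exact (norm_add_le _ _).trans (by rw [Complex.norm_conj])
      linarith
    · show (recTerm G (Function.update (fun n => ((g n : ℝ) : ℂ)) i (t : ℂ)) X.1 X.2 φ +
          conj (recTerm G (Function.update (fun n => ((g n : ℝ) : ℂ)) i (conj (t : ℂ))) X.1 X.2 φ)) / 2 = _
      have hup : (fun n => ((Function.update g i t n : ℝ) : ℂ)) = Function.update (fun n => ((g n : ℝ) : ℂ)) i (t : ℂ) :=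
        Function.comp_update (fun x : ℝ => (x : ℂ)) g i t
      rw [Complex.conj_ofReal, functionalC_truncRun_of_le _ _ φ X hXK, functionalC_toClusterTower, hup, Complex.add_conj]
      push_cast
      ring

end SupLetter

/-! ## §2 θ-form at the admissible reading of record on the generated run towers -/

section Theta

variable {F : T4Family} (θ : Stage12Params F N) (G : (k : ℕ) → GenTower (F.P k) (MatA N) θ.τ9.M)
  (sp : (k j : ℕ) → (domSys (F.P k) θ.τ9.M j).Dom → Set (CPair (F.P k) (MatA N)))
  (gauge : (k : ℕ) → GaugeField (F.P k) 0 (Node00.SU N) → GaugeField (F.P k) 0 (Node00.SU N) → ℝ) (hg : ∀ k U U', 0 ≤ gauge k U U')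
  (T₀ : (k : ℕ) → GaugeField (F.P (k + 1)) 0 (Node00.SU N) → GaugeField (F.P k) 0 (Node00.SU N))
  (hT₀ : ∀ (k : ℕ) (U : GaugeField (F.P (k + 1)) 0 (Node00.SU N)),
    (∀ (j : ℕ) (Y : (domSys (F.P (k + 1)) θ.τ9.M j).Dom), ofBackgroundC (ιSU N) U ∈ sp (k + 1) j Y) →
    ∀ (j : ℕ) (Y : (domSys (F.P k) θ.τ9.M j).Dom), ofBackgroundC (ιSU N) (T₀ k U) ∈ sp k j Y)
  (li : LetterInputs) (k : ℕ)

/-- **N18 BELOW `k` ⇒ N22 AT `k` AT THE ADMISSIBLE READING OF RECORD ON THE GENERATED RUN TOWERS, ONE STAGE-12 TUPLE.**  For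
`D := ReadingData.ofRecordAdm F θ.τ9.M N (runTowers fun k ↦ toClusterTower (G k)) sp gauge hg T₀ hT₀ li`: `N18At` at the bundles `u3OfRecord₁₂ θ (D.u3Objects θ.γ) k′`,
`k′ < k`; the SCHEMA PACKAGE at the `k`-th torus — `∃ Dk Adm`, `Dk` open, conjugation-symmetric and ⊇ the closed `li.r`-discs about `]0, θ.γ]`, `RecAdmissible (G k) Dk Adm`,
(A-last)ₘ and (A-prop)ₘ at every step of `G k` on `Dk` for the table `sp k`, and the complex sup letter for the levels `j ≤ k` (`li.A·li.μ^{j−1−i}·e^{−li.κ d_j(X)}`); the eleven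
numerals; `0 < θ.γ` ⟹ `N22At (u3OfRecord₁₂ θ (D.u3Objects θ.γ) k)`.  Module 8a §1 with the junk pin (J) DISCHARGED by `termlessBeyond_runTowers` and the analytic letter (A)
by §1 at `φ := (ιU, 0)`, `U` admissible (`U.2`). [folklore] -/
theorem n22At_u3OfRecord₁₂_ofRecordAdm_gen_of_n18Below_schemas
    (h18 : ∀ k' : ℕ, k' < k → N18At (u3OfRecord₁₂ θ
      ((ReadingData.ofRecordAdm F θ.τ9.M N (runTowers fun k => toClusterTower (G k)) sp gauge hg T₀ hT₀ li).u3Objects θ.γ) k'))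
    (hsch : ∃ (Dk : Set ℂ) (Adm : (m : ℕ) → Set (OlderTerms (F.P k) (MatA N) θ.τ9.M m)),
      IsOpen Dk ∧ (∀ z ∈ Dk, conj z ∈ Dk) ∧ (∀ t ∈ Ioc (0 : ℝ) θ.γ, closedBall (t : ℂ) li.r ⊆ Dk) ∧
      RecAdmissible (G k) Dk Adm ∧
      (∀ m : ℕ, (G k m).AnalyticInLast Dk (Adm m) (sp k (m + 1))) ∧
      (∀ m : ℕ, (G k m).PropagatesAnalyticity Dk (Adm m) (fun j : Fin (m + 1) => sp k j) (sp k (m + 1))) ∧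
      (∀ g ∈ Window θ.γ, ∀ (i j : ℕ), i < j → j ≤ k → ∀ (X : (domSys (F.P k) θ.τ9.M j).Dom), ∀ φ ∈ sp k j X, ∀ z ∈ Dk,
        ‖recTerm (G k) (Function.update (fun n => ((g n : ℝ) : ℂ)) i z) j X φ‖ ≤
          li.A * li.μ ^ (j - 1 - i) * Real.exp (-(li.κ * (domSys (F.P k) θ.τ9.M j).dj X))))
    (hnum : 0 < li.C₀ ∧ 0 < li.θ₅ ∧ li.θ₅ < 1 ∧ 0 ≤ li.C₅ ∧ 2 * li.C₅ / (1 - li.θ₅) ≤ li.C₀ ∧ 0 < li.A ∧ li.θ₅ ≤ li.μ ∧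
      li.C₀ ≤ 2 * li.A ∧ 0 < li.r ∧ 0 < li.s ∧ li.s < 1)
    (hγ : 0 < θ.γ) :
    N22At (u3OfRecord₁₂ θ
      ((ReadingData.ofRecordAdm F θ.τ9.M N (runTowers fun k => toClusterTower (G k)) sp gauge hg T₀ hT₀ li).u3Objects θ.γ) k) := by
  obtain ⟨Dk, Adm, hDo, hDc, hDr, hAdm, hlast, hprop, hB⟩ := hsch
  have hθ5 : 0 < li.θ₅ := hnum.2.1
  have hA : 0 < li.A := hnum.2.2.2.2.2.1
  have hθμ : li.θ₅ ≤ li.μ := hnum.2.2.2.2.2.2.1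
  have hr : 0 < li.r := hnum.2.2.2.2.2.2.2.2.1
  refine n22At_u3OfRecord₁₂_ofRecordAdm_of_n18Below_analytic θ (runTowers fun k => toClusterTower (G k)) sp gauge hg T₀ hT₀ li k h18
    (fun k X hk g φ => (termlessBeyond_runTowers (fun k => toClusterTower (G k)) k).functionalC_eq_zero g φ X hk)
    (fun g hg' U X i hi => ?_) hnum hγ
  exact supLetterA_truncRun_toClusterTower_of_schemas (G k) k (sp k) hDo hDc hDr hr.le hAdm hlast hprop hA.le (hθ5.le.trans hθμ) hB
    (ofBackgroundC (ιSU N) U.1) U.2 g hg' X i hi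

end Theta

/-! ## §3 Stub level: `S_N22` at the W1 reading whose component is the admissible reading on the generated run towers -/

section Stub

variable (G : (F : T4Family) → (θ : Stage12Params F N) → (k : ℕ) → GenTower (F.P k) (MatA N) θ.τ9.M)
  (sp : (F : T4Family) → (θ : Stage12Params F N) → (k j : ℕ) → (domSys (F.P k) θ.τ9.M j).Dom → Set (CPair (F.P k) (MatA N)))
  (gauge : (F : T4Family) → (θ : Stage12Params F N) → (k : ℕ) → GaugeField (F.P k) 0 (Node00.SU N) → GaugeField (F.P k) 0 (Node00.SU N) → ℝ)
  (hg : ∀ (F : T4Family) (θ : Stage12Params F N) (k : ℕ) (U U' : GaugeField (F.P k) 0 (Node00.SU N)), 0 ≤ gauge F θ k U U')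
  (T₀ : (F : T4Family) → (θ : Stage12Params F N) → (k : ℕ) → GaugeField (F.P (k + 1)) 0 (Node00.SU N) → GaugeField (F.P k) 0 (Node00.SU N))
  (hT₀ : ∀ (F : T4Family) (θ : Stage12Params F N) (k : ℕ) (U : GaugeField (F.P (k + 1)) 0 (Node00.SU N)),
    (∀ (j : ℕ) (Y : (domSys (F.P (k + 1)) θ.τ9.M j).Dom), ofBackgroundC (ιSU N) U ∈ sp F θ (k + 1) j Y) →
    ∀ (j : ℕ) (Y : (domSys (F.P k) θ.τ9.M j).Dom), ofBackgroundC (ιSU N) (T₀ F θ k U) ∈ sp F θ k j Y)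
  (li : (F : T4Family) → Stage12Params F N → LetterInputs)
  (ne1 : (F : T4Family) → Stage12Params F N → (ℕ → ℝ) → List (ULoop F) → NE1pCarriers)

/-- **`S_N22` AT THE CANONICAL HOME `RRec₁₂ 𝔯_W1` FROM `S_N18` AND THE SCHEMAS**, for ANY residual inputs `𝔇` whose W1 component IS the admissible reading of record on
the generated run towers (`h𝔇`): `S_N18 (RRec₁₂ 𝔯_W1)` + per admissible Stage-12 tuple with provisos and run length `k` the schema package of §2 at the `k`-th torus +
the eleven numerals ⟹ `S_N22 (RRec₁₂ 𝔯_W1)` (`𝔯_W1 := RateReading₁₂.ofAssignment (assignment₁₂ 𝔇) ne1`).  NO junk pin, NO coherence, NO readings clause. [folklore] -/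
theorem s_N22_rRec₁₂_w1_gen_of_s_N18_schemas (𝔇 : AssignmentInputs₁₂ N)
    (h𝔇 : ∀ (F : T4Family) (θ : Stage12Params F N), 𝔇.w1 F θ =
      ReadingData.ofRecordAdm F θ.τ9.M N (runTowers fun k => toClusterTower (G F θ k)) (sp F θ) (gauge F θ) (hg F θ) (T₀ F θ) (hT₀ F θ) (li F θ))
    (h18 : S_N18 (RRec₁₂ (RateReading₁₂.ofAssignment (assignment₁₂ 𝔇) ne1)))
    (hsch : ∀ (F : T4Family) (θ : Stage12Params F N), θ.Provisos₁₂ F N → θ.Admissible F N → ∀ (k : ℕ),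
      ∃ (Dk : Set ℂ) (Adm : (m : ℕ) → Set (OlderTerms (F.P k) (MatA N) θ.τ9.M m)),
        IsOpen Dk ∧ (∀ z ∈ Dk, conj z ∈ Dk) ∧ (∀ t ∈ Ioc (0 : ℝ) θ.γ, closedBall (t : ℂ) (li F θ).r ⊆ Dk) ∧
        RecAdmissible (G F θ k) Dk Adm ∧
        (∀ m : ℕ, (G F θ k m).AnalyticInLast Dk (Adm m) (sp F θ k (m + 1))) ∧
        (∀ m : ℕ, (G F θ k m).PropagatesAnalyticity Dk (Adm m) (fun j : Fin (m + 1) => sp F θ k j) (sp F θ k (m + 1))) ∧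
        (∀ g ∈ Window θ.γ, ∀ (i j : ℕ), i < j → j ≤ k → ∀ (X : (domSys (F.P k) θ.τ9.M j).Dom), ∀ φ ∈ sp F θ k j X, ∀ z ∈ Dk,
          ‖recTerm (G F θ k) (Function.update (fun n => ((g n : ℝ) : ℂ)) i z) j X φ‖ ≤
            (li F θ).A * (li F θ).μ ^ (j - 1 - i) * Real.exp (-((li F θ).κ * (domSys (F.P k) θ.τ9.M j).dj X))))
    (hnum : ∀ (F : T4Family) (θ : Stage12Params F N), θ.Provisos₁₂ F N → θ.Admissible F N →
      0 < (li F θ).C₀ ∧ 0 < (li F θ).θ₅ ∧ (li F θ).θ₅ < 1 ∧ 0 ≤ (li F θ).C₅ ∧ 2 * (li F θ).C₅ / (1 - (li F θ).θ₅) ≤ (li F θ).C₀ ∧ 0 < (li F θ).A ∧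
        (li F θ).θ₅ ≤ (li F θ).μ ∧ (li F θ).C₀ ≤ 2 * (li F θ).A ∧ 0 < (li F θ).r ∧ 0 < (li F θ).s ∧ (li F θ).s < 1) :
    S_N22 (RRec₁₂ (RateReading₁₂.ofAssignment (assignment₁₂ 𝔇) ne1)) := by
  rw [s_N22_rRec₁₂_w1_iff]
  rw [s_N18_rRec₁₂_iff] at h18
  intro F D h k
  show N22At (u3OfRecord₁₂ h.params ((𝔇.w1 F h.params).u3Objects h.params.γ) k)
  rw [h𝔇 F h.params]
  refine n22At_u3OfRecord₁₂_ofRecordAdm_gen_of_n18Below_schemas h.params (G F h.params) (sp F h.params) (gauge F h.params) (hg F h.params)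
    (T₀ F h.params) (hT₀ F h.params) (li F h.params) k (fun k' _ => ?_) (hsch F h.params h.provisos h.admissible k)
    (hnum F h.params h.provisos h.admissible) h.gamma_pos
  have h18' : N18At (u3OfRecord₁₂ h.params ((𝔇.w1 F h.params).u3Objects h.params.γ) k') := h18 F D h (fun _ => 0) [] k'
  rw [h𝔇 F h.params] at h18'
  exact h18'

/-- **THE SAME AT THE REGIME ∕ TUPLE HOME** `RRec₁₂On 𝔯_W1 Rg` (any regime `Rg`; the hypotheses asked only of the admissible tuples with provisos in the regime). [folklore] -/
theorem s_N22_rRec₁₂On_w1_gen_of_s_N18_schemas (𝔇 : AssignmentInputs₁₂ N) (Rg : (F : T4Family) → Stage12Params F N → Prop)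
    (h𝔇 : ∀ (F : T4Family) (θ : Stage12Params F N), 𝔇.w1 F θ =
      ReadingData.ofRecordAdm F θ.τ9.M N (runTowers fun k => toClusterTower (G F θ k)) (sp F θ) (gauge F θ) (hg F θ) (T₀ F θ) (hT₀ F θ) (li F θ))
    (h18 : S_N18 (RRec₁₂On (RateReading₁₂.ofAssignment (assignment₁₂ 𝔇) ne1) Rg))
    (hsch : ∀ (F : T4Family) (θ : Stage12Params F N), θ.Provisos₁₂ F N → Rg F θ → θ.Admissible F N → ∀ (k : ℕ),
      ∃ (Dk : Set ℂ) (Adm : (m : ℕ) → Set (OlderTerms (F.P k) (MatA N) θ.τ9.M m)),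
        IsOpen Dk ∧ (∀ z ∈ Dk, conj z ∈ Dk) ∧ (∀ t ∈ Ioc (0 : ℝ) θ.γ, closedBall (t : ℂ) (li F θ).r ⊆ Dk) ∧
        RecAdmissible (G F θ k) Dk Adm ∧
        (∀ m : ℕ, (G F θ k m).AnalyticInLast Dk (Adm m) (sp F θ k (m + 1))) ∧
        (∀ m : ℕ, (G F θ k m).PropagatesAnalyticity Dk (Adm m) (fun j : Fin (m + 1) => sp F θ k j) (sp F θ k (m + 1))) ∧
        (∀ g ∈ Window θ.γ, ∀ (i j : ℕ), i < j → j ≤ k → ∀ (X : (domSys (F.P k) θ.τ9.M j).Dom), ∀ φ ∈ sp F θ k j X, ∀ z ∈ Dk,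
          ‖recTerm (G F θ k) (Function.update (fun n => ((g n : ℝ) : ℂ)) i z) j X φ‖ ≤
            (li F θ).A * (li F θ).μ ^ (j - 1 - i) * Real.exp (-((li F θ).κ * (domSys (F.P k) θ.τ9.M j).dj X))))
    (hnum : ∀ (F : T4Family) (θ : Stage12Params F N), θ.Provisos₁₂ F N → Rg F θ → θ.Admissible F N →
      0 < (li F θ).C₀ ∧ 0 < (li F θ).θ₅ ∧ (li F θ).θ₅ < 1 ∧ 0 ≤ (li F θ).C₅ ∧ 2 * (li F θ).C₅ / (1 - (li F θ).θ₅) ≤ (li F θ).C₀ ∧ 0 < (li F θ).A ∧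
        (li F θ).θ₅ ≤ (li F θ).μ ∧ (li F θ).C₀ ≤ 2 * (li F θ).A ∧ 0 < (li F θ).r ∧ 0 < (li F θ).s ∧ (li F θ).s < 1) :
    S_N22 (RRec₁₂On (RateReading₁₂.ofAssignment (assignment₁₂ 𝔇) ne1) Rg) := by
  rw [s_N22_rRec₁₂On_iff]
  rw [s_N18_rRec₁₂On_iff] at h18
  intro F θ hP hRg hθ g₀ os k
  show N22At (u3OfRecord₁₂ θ ((𝔇.w1 F θ).u3Objects θ.γ) k)
  rw [h𝔇 F θ]
  refine n22At_u3OfRecord₁₂_ofRecordAdm_gen_of_n18Below_schemas θ (G F θ) (sp F θ) (gauge F θ) (hg F θ) (T₀ F θ) (hT₀ F θ) (li F θ) k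
    (fun k' _ => ?_) (hsch F θ hP hRg hθ k) (hnum F θ hP hRg hθ) hθ.toStage9.gamma_pos
  have h18' : N18At (u3OfRecord₁₂ θ ((𝔇.w1 F θ).u3Objects θ.γ) k') := h18 F θ hP hRg hθ g₀ os k'
  rw [h𝔇 F θ] at h18'
  exact h18'

/-- **THE SAME AT THE READING OF RECORD, EDITION 1** — module 6's `readingOfRecord₁₂ w1 ℓ₃ ne2 ne1` with
`w1 F θ := ReadingData.ofRecordAdm F θ.τ9.M N (runTowers fun k ↦ toClusterTower (G F θ k)) (sp F θ) …` (canonical home; `h𝔇 := rfl`). [folklore] -/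
theorem s_N22_readingOfRecord₁₂_gen_of_s_N18_schemas (ℓ₃ : T4Family → NE3Letters₁₁)
    (ne2 : (F : T4Family) → Stage12Params F N → (ℕ → ℝ) → List (ULoop F) → ℕ → NE2Objects₁₁)
    (h18 : S_N18 (RRec₁₂ (readingOfRecord₁₂ (fun F θ =>
      ReadingData.ofRecordAdm F θ.τ9.M N (runTowers fun k => toClusterTower (G F θ k)) (sp F θ) (gauge F θ) (hg F θ) (T₀ F θ) (hT₀ F θ) (li F θ))
      ℓ₃ ne2 ne1)))
    (hsch : ∀ (F : T4Family) (θ : Stage12Params F N), θ.Provisos₁₂ F N → θ.Admissible F N → ∀ (k : ℕ),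
      ∃ (Dk : Set ℂ) (Adm : (m : ℕ) → Set (OlderTerms (F.P k) (MatA N) θ.τ9.M m)),
        IsOpen Dk ∧ (∀ z ∈ Dk, conj z ∈ Dk) ∧ (∀ t ∈ Ioc (0 : ℝ) θ.γ, closedBall (t : ℂ) (li F θ).r ⊆ Dk) ∧
        RecAdmissible (G F θ k) Dk Adm ∧
        (∀ m : ℕ, (G F θ k m).AnalyticInLast Dk (Adm m) (sp F θ k (m + 1))) ∧
        (∀ m : ℕ, (G F θ k m).PropagatesAnalyticity Dk (Adm m) (fun j : Fin (m + 1) => sp F θ k j) (sp F θ k (m + 1))) ∧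
        (∀ g ∈ Window θ.γ, ∀ (i j : ℕ), i < j → j ≤ k → ∀ (X : (domSys (F.P k) θ.τ9.M j).Dom), ∀ φ ∈ sp F θ k j X, ∀ z ∈ Dk,
          ‖recTerm (G F θ k) (Function.update (fun n => ((g n : ℝ) : ℂ)) i z) j X φ‖ ≤
            (li F θ).A * (li F θ).μ ^ (j - 1 - i) * Real.exp (-((li F θ).κ * (domSys (F.P k) θ.τ9.M j).dj X))))
    (hnum : ∀ (F : T4Family) (θ : Stage12Params F N), θ.Provisos₁₂ F N → θ.Admissible F N →
      0 < (li F θ).C₀ ∧ 0 < (li F θ).θ₅ ∧ (li F θ).θ₅ < 1 ∧ 0 ≤ (li F θ).C₅ ∧ 2 * (li F θ).C₅ / (1 - (li F θ).θ₅) ≤ (li F θ).C₀ ∧ 0 < (li F θ).A ∧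
        (li F θ).θ₅ ≤ (li F θ).μ ∧ (li F θ).C₀ ≤ 2 * (li F θ).A ∧ 0 < (li F θ).r ∧ 0 < (li F θ).s ∧ (li F θ).s < 1) :
    S_N22 (RRec₁₂ (readingOfRecord₁₂ (fun F θ =>
      ReadingData.ofRecordAdm F θ.τ9.M N (runTowers fun k => toClusterTower (G F θ k)) (sp F θ) (gauge F θ) (hg F θ) (T₀ F θ) (hT₀ F θ) (li F θ))
      ℓ₃ ne2 ne1)) :=
  s_N22_rRec₁₂_w1_gen_of_s_N18_schemas G sp gauge hg T₀ hT₀ li ne1 (pinnedInputs₁₂ _ ℓ₃ ne2) (fun _ _ => rfl) h18 hsch hnum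

/-- **THE SAME AT THE READING OF RECORD, EDITION 1, REGIME ∕ TUPLE HOME** `RRec₁₂On (readingOfRecord₁₂ w1 ℓ₃ ne2 ne1) Rg` (any `Rg`; the form dag-n27-c's
`spine_rec12COn_at_readingOfRecord₁₂` reads; `h𝔇 := rfl`). [folklore] -/
theorem s_N22_readingOfRecord₁₂On_gen_of_s_N18_schemas (ℓ₃ : T4Family → NE3Letters₁₁)
    (ne2 : (F : T4Family) → Stage12Params F N → (ℕ → ℝ) → List (ULoop F) → ℕ → NE2Objects₁₁) (Rg : (F : T4Family) → Stage12Params F N → Prop)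
    (h18 : S_N18 (RRec₁₂On (readingOfRecord₁₂ (fun F θ =>
      ReadingData.ofRecordAdm F θ.τ9.M N (runTowers fun k => toClusterTower (G F θ k)) (sp F θ) (gauge F θ) (hg F θ) (T₀ F θ) (hT₀ F θ) (li F θ))
      ℓ₃ ne2 ne1) Rg))
    (hsch : ∀ (F : T4Family) (θ : Stage12Params F N), θ.Provisos₁₂ F N → Rg F θ → θ.Admissible F N → ∀ (k : ℕ),
      ∃ (Dk : Set ℂ) (Adm : (m : ℕ) → Set (OlderTerms (F.P k) (MatA N) θ.τ9.M m)),
        IsOpen Dk ∧ (∀ z ∈ Dk, conj z ∈ Dk) ∧ (∀ t ∈ Ioc (0 : ℝ) θ.γ, closedBall (t : ℂ) (li F θ).r ⊆ Dk) ∧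
        RecAdmissible (G F θ k) Dk Adm ∧
        (∀ m : ℕ, (G F θ k m).AnalyticInLast Dk (Adm m) (sp F θ k (m + 1))) ∧
        (∀ m : ℕ, (G F θ k m).PropagatesAnalyticity Dk (Adm m) (fun j : Fin (m + 1) => sp F θ k j) (sp F θ k (m + 1))) ∧
        (∀ g ∈ Window θ.γ, ∀ (i j : ℕ), i < j → j ≤ k → ∀ (X : (domSys (F.P k) θ.τ9.M j).Dom), ∀ φ ∈ sp F θ k j X, ∀ z ∈ Dk,
          ‖recTerm (G F θ k) (Function.update (fun n => ((g n : ℝ) : ℂ)) i z) j X φ‖ ≤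
            (li F θ).A * (li F θ).μ ^ (j - 1 - i) * Real.exp (-((li F θ).κ * (domSys (F.P k) θ.τ9.M j).dj X))))
    (hnum : ∀ (F : T4Family) (θ : Stage12Params F N), θ.Provisos₁₂ F N → Rg F θ → θ.Admissible F N →
      0 < (li F θ).C₀ ∧ 0 < (li F θ).θ₅ ∧ (li F θ).θ₅ < 1 ∧ 0 ≤ (li F θ).C₅ ∧ 2 * (li F θ).C₅ / (1 - (li F θ).θ₅) ≤ (li F θ).C₀ ∧ 0 < (li F θ).A ∧
        (li F θ).θ₅ ≤ (li F θ).μ ∧ (li F θ).C₀ ≤ 2 * (li F θ).A ∧ 0 < (li F θ).r ∧ 0 < (li F θ).s ∧ (li F θ).s < 1) :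
    S_N22 (RRec₁₂On (readingOfRecord₁₂ (fun F θ =>
      ReadingData.ofRecordAdm F θ.τ9.M N (runTowers fun k => toClusterTower (G F θ k)) (sp F θ) (gauge F θ) (hg F θ) (T₀ F θ) (hT₀ F θ) (li F θ))
      ℓ₃ ne2 ne1) Rg) :=
  s_N22_rRec₁₂On_w1_gen_of_s_N18_schemas G sp gauge hg T₀ hT₀ li ne1 (pinnedInputs₁₂ _ ℓ₃ ne2) Rg (fun _ _ => rfl) h18 hsch hnum

end Stub

/-! ## §4 Non-vacuity of the schema package (A5 rider): the termless generator -/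

section Nonvacuity

variable {P : Params} {𝔸 : Type*} {M : ℕ}

omit [NeZero N] in
open Classical in
/-- **THE SCHEMA PACKAGE IS SATISFIABLE (A5 rider) — AND INHABITATION IS NOT CONTENT.**  For every table `sp`, window radius `γ`, letters `A, μ ≥ 0`, `κ`, `r` and run length
`K` there are a generator, a domain and admissible classes carrying the whole package of §2: the TERMLESS generator (no indices at any step, so every (2.11) sum is empty and
every generated term is `0`) with `Dk := univ`, `Adm := univ`.  So §2–§3 are not vacuous implications; and a discharge keyed to this reading must NAME its generator. [folklore] -/
theorem genSchemas_nonvacuous (sp : (j : ℕ) → (domSys P M j).Dom → Set (CPair P 𝔸)) (γ : ℝ) {A μ : ℝ} (κ r : ℝ) (K : ℕ) (hA : 0 ≤ A) (hμ : 0 ≤ μ) :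
    ∃ (G : GenTower P 𝔸 M) (Dk : Set ℂ) (Adm : (m : ℕ) → Set (OlderTerms P 𝔸 M m)),
      IsOpen Dk ∧ (∀ z ∈ Dk, conj z ∈ Dk) ∧ (∀ t ∈ Ioc (0 : ℝ) γ, closedBall (t : ℂ) r ⊆ Dk) ∧
      RecAdmissible G Dk Adm ∧
      (∀ m : ℕ, (G m).AnalyticInLast Dk (Adm m) (sp (m + 1))) ∧
      (∀ m : ℕ, (G m).PropagatesAnalyticity Dk (Adm m) (fun j : Fin (m + 1) => sp j) (sp (m + 1))) ∧
      (∀ g ∈ Window γ, ∀ (i j : ℕ), i < j → j ≤ K → ∀ (X : (domSys P M j).Dom), ∀ φ ∈ sp j X, ∀ z ∈ Dk,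
        ‖recTerm G (Function.update (fun n => ((g n : ℝ) : ℂ)) i z) j X φ‖ ≤ A * μ ^ (j - 1 - i) * Real.exp (-(κ * (domSys P M j).dj X))) := by
  -- the termless generator and the vanishing of its one-step map
  let G : GenTower P 𝔸 M := fun m => ⟨PEmpty, fun _ => ∅, fun i => nomatch i⟩
  have hE : ∀ (m : ℕ) (t : ℂ) (old : OlderTerms P 𝔸 M m) (φ : CPair P 𝔸) (X : (domSys P M (m + 1)).Dom), (G m).E t old φ X = 0 := by
    intro m t old φ X
    have h1 : (G m).E t old φ X = (termlessTower P 𝔸 M m).E (fun _ => 0) φ X := by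
      unfold StepGen.E ClusterStep.E
      congr 1
    rw [h1]
    exact E_termlessTower m _ φ X
  have hrec : ∀ (g : ℕ → ℂ) (j : ℕ) (X : (domSys P M j).Dom) (φ : CPair P 𝔸), recTerm G g j X φ = 0 := by
    intro g j X φ
    cases j with
    | zero => exact recTerm_zero G g X φ
    | succ m => rw [recTerm_succ]; exact hE m _ _ φ X
  refine ⟨G, univ, fun _ => univ, isOpen_univ, fun z _ => mem_univ _, fun t _ => subset_univ _, fun g _ m => mem_univ _,
    fun m old _ X φ _ => ?_, fun m c _ _ t _ X φ _ => ?_, fun g _ i j _ _ X φ _ z _ => ?_⟩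
  · have : (fun t : ℂ => (G m).E t old φ X) = fun _ => 0 := funext fun t => hE m t old φ X
    rw [this]
    exact analyticOnNhd_const
  · have : (fun s : ℂ => (G m).E t (c s) φ X) = fun _ => 0 := funext fun s => hE m t (c s) φ X
    rw [this]
    exact analyticOnNhd_const
  · rw [hrec, norm_zero]
    exact mul_nonneg (mul_nonneg hA (pow_nonneg hμ _)) (Real.exp_nonneg _)

end Nonvacuity

end YMDAG.N22

end
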